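import Literature.AnabelianGeometry.EtaleTheta.Discharge.Sec3Cor38Rows
import Literature.AnabelianGeometry.EtaleTheta.Discharge.Sec3Thm37Holds
import Literature.AlgebraicGeometry.Frobenioids.ModelFrobenioidPullbacks
import HarnessLib

/-!
# [EtTh] Corollary 3.8 sub-DAG, row C38-L07b `BsFldOfFactorisation`: the exact criterion over the typed
# tempered-Frobenioid interface (FROZEN FACT-LIST row F-2819)

Mochizuki, *The étale theta function …*, Publ. RIMS **45** (2009), Cor. 3.8, proof PDF p. 81 l.15–19
[cite: MochizukiEtTh2009, Cor 3.8 p.81]: "`Ψ` preserves … the factorization [cf. [Mzk17], Definition 1.3, (iv), (a)]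
of a morphism of `C_i` into a composite of a morphism of Frobenius type, a pre-step, and a pull-back morphism.
Thus … `Ψ` preserves the base-field-theoretic morphisms".  abc-iut cell, block F (fact-proving wave), seat
abc-iut-f-004, FROZEN FACT-LIST row **F-2819** = abc-iut-w5-d124's named row **C38-L07b**
`TemperedFrobenioid.BsFldOfFactorisation C` (`TemperedFrobenioidCor38Sub.lean`): for `f = F ≫ φ ≫ λ` with `F` of
Frobenius type, `φ` a pre-step and `λ` a pull-back morphism of the model-Frobenioid category `C.category` of a
tempered Frobenioid, `f` is base-field-theoretic iff `φ` is.

The row is a SCHEMA over an arbitrary inhabitant `C` of the typed interface `TemperedFrobenioid T D VD`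
(Def. 3.6 (ii); the [FrdI] vocabularies `V`, `VD` are stubs).  abc-iut-w5-d124 proved it under
`hF : IsFrobenioid C.toElem` (`TemperedFrobenioid.bsFldOfFactorisation_of_isFrobenioid`, `Sec3Cor38Rows.lean`).
This proof-only companion settles the row over the bare interface:

* `Cor38BsFld.degFr_eq_one_and_isUnit_div_of_isPullbackMorphism` — in ANY model Frobenioid
  `ModelFrobenioid Φ B DivB` ([FrdI] Thm. 5.2 (i)) a pull-back morphism is linear and its zero divisor is a UNIT of
  `Φ(A)` (test object `(A_D, Base(φ)^* β)`; no hypothesis on `Φ`, `B`) — the unit-form of L1's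
  `ModelFrobenioid.degFr_div_of_isPullbackMorphism`, which concludes `Div = 0` for DIVISORIAL (sharp) `Φ`;
* `Cor38BsFld.isPullbackMorphism_of_isUnit_div` — conversely a linear morphism with unit zero divisor IS a
  pull-back morphism as soon as `B` is group-like (the unit-form of L1's `ModelFrobenioid.isPullbackMorphism_of`);
* **`TemperedFrobenioid.bsFldOfFactorisation_iff_isUnit`** — the EXACT CRITERION:
  `C.BsFldOfFactorisation ↔ ∀ A (u ∈ Φ(A)ˣ), u ∈ Φ^{bs-fld}(A)`; in particular
* `TemperedFrobenioid.bsFldOfFactorisation_of_isSharp` / `_of_isDivisorial` — the row HOLDS whenever the divisor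
  monoids `Φ(A)` are sharp (e.g. divisorial, as in print: "`Φ` … determines a perf-factorial divisorial monoid on `D`",
  Def. 3.6 (ii) p. 76 — carried in the tree only by the stub `VD.IsDivisorialOn`), a WEAKER sufficient hypothesis
  than `IsFrobenioid C.toElem`;
* `TemperedFrobenioid.not_bsFldOfFactorisation_of_isUnit` — and FAILS at any inhabitant with a unit of some `Φ(A)`
  outside `Φ^{bs-fld}(A)`; such an inhabitant of the typed interface exists (`Sec3Cor38BsFldOfFactorisationToy.lean`,
  `Φ = ℤ × ℤ_{≥0}`), so the row's universal closure is false while its instance forms above are theorems.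

HONEST FRAMING: statements about the TYPED interface stack of Def. 3.3/3.6; refereed pre-IUT material; for the
tempered Frobenioid of a curve `Φ` is divisorial and the row is the printed triviality; nothing here bears on
[IUTchIII] Cor. 3.12; typed ≠ proved elsewhere.
-/

noncomputable section

namespace Literature.AnabelianGeometry.EtaleTheta

open CategoryTheory Opposite Literature.AlgebraicGeometry.Frobenioids

universe u₀ v₀ u v w

/-! ### Pull-back morphisms of a model Frobenioid: linear with UNIT zero divisor -/

namespace Cor38BsFld

variable {D : Type u} [Category.{v} D] {Φ B : Dᵒᵖ ⥤ CommMonCat.{w}} {DivB : B ⟶ monoidGp Φ}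
  {X Y : ModelFrobenioid Φ B DivB}

/-- In a model Frobenioid `C = ModelFrobenioid Φ B DivB` ([FrdI] Thm. 5.2 (i)) a pull-back morphism `φ` ([FrdI]
Def. 1.2 (ii)) is linear and `Div(φ)` is a unit of `Φ(A_D)`: test the universal property against
`(A_D, Base(φ)^* β) → (B_D, β)` (no hypothesis on `Φ` or `B`; for sharp `Φ` this is L1's
`ModelFrobenioid.degFr_div_of_isPullbackMorphism`). [cite: MochizukiFrdI2008, Thm. 5.2(ii) p.101] -/
theorem degFr_eq_one_and_isUnit_div_of_isPullbackMorphism {φ : X ⟶ Y}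
    (h : PreFrobenioid.IsPullbackMorphism (ModelFrobenioid.toElem Φ B DivB) φ) :
    ModelFrobenioid.degFr φ = 1 ∧ IsUnit (ModelFrobenioid.div φ) := by
  let f : X.base ⟶ Y.base := ModelFrobenioid.baseMap φ
  let W : ModelFrobenioid Φ B DivB := ⟨X.base, pullGp Φ f Y.cls⟩
  let δ : W ⟶ Y := ModelFrobenioid.mkHom W Y 1 f 1 1 (by
    show pullGp Φ f Y.cls ^ ((1 : ℕ+) : ℕ) * Algebra.GrothendieckGroup.of 1 =
      pullGp Φ f Y.cls * divB Φ B DivB (op X.base) 1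
    rw [PNat.one_coe, pow_one, map_one, mul_one, map_one, mul_one])
  obtain ⟨γ, hγ⟩ := (h W).2 ⟨(δ, 𝟙 X.base), show f = 𝟙 X.base ≫ f from (Category.id_comp _).symm⟩
  have e1 : γ ≫ φ = δ :=
    congrArg (fun p : PreFrobenioid.PullbackHomData (ModelFrobenioid.toElem Φ B DivB) φ W => p.1.1) hγ
  have e2 : ModelFrobenioid.baseMap γ = 𝟙 X.base :=
    congrArg (fun p : PreFrobenioid.PullbackHomData (ModelFrobenioid.toElem Φ B DivB) φ W => p.1.2) hγ
  have hn : ModelFrobenioid.degFr φ * ModelFrobenioid.degFr γ = 1 := congrArg ModelFrobenioid.Hom.degFr e1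
  have hd : pull Φ (ModelFrobenioid.baseMap γ) (ModelFrobenioid.div φ) *
      ModelFrobenioid.div γ ^ (ModelFrobenioid.degFr φ : ℕ) = 1 := congrArg ModelFrobenioid.Hom.div e1
  have hφ : ModelFrobenioid.degFr φ = 1 := pnat_eq_one_of_mul_eq_one hn
  rw [e2, pull_id, hφ, PNat.one_coe, pow_one] at hd
  exact ⟨hφ, IsUnit.of_mul_eq_one _ hd⟩

/-- Bookkeeping in a commutative group. [folklore] -/
private theorem inv_mul_rearrange {G : Type w} [CommGroup G] (a b c x : G) :
    a⁻¹ * (x * a * b⁻¹ * c) = x * (b⁻¹ * c) := by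
  rw [mul_comm x a, mul_assoc, mul_assoc, inv_mul_cancel_left]

/-- Conversely, in a model Frobenioid with `B` group-like, a LINEAR morphism `φ` whose zero divisor is a UNIT of
`Φ(A_D)` is a pull-back morphism: the unique lift of `(δ : W → B, ε : W_D → A_D)` is
`(deg_Fr(δ), ε, Div(δ) − ε^*Div(φ), u_δ − ε^*u_φ)` (the unit-form of L1's `ModelFrobenioid.isPullbackMorphism_of`,
which treats `Div(φ) = 0` over integral `Φ`). [cite: MochizukiFrdI2008, Thm. 5.2(ii) p.101] -/
theorem isPullbackMorphism_of_isUnit_div (hBg : Objectwise (fun M _ => IsGroupLike M) B) {φ : X ⟶ Y}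
    (hn : ModelFrobenioid.degFr φ = 1) (hd : IsUnit (ModelFrobenioid.div φ)) :
    PreFrobenioid.IsPullbackMorphism (ModelFrobenioid.toElem Φ B DivB) φ := by
  obtain ⟨uu, huu⟩ := (hBg X.base).isUnit (ModelFrobenioid.unit φ)
  obtain ⟨ud, hud⟩ := hd
  have hφ : X.cls * Algebra.GrothendieckGroup.of (ModelFrobenioid.div φ) =
      pullGp Φ (ModelFrobenioid.baseMap φ) Y.cls * divB Φ B DivB _ (ModelFrobenioid.unit φ) := by
    have h := ModelFrobenioid.rel φ
    rwa [hn, PNat.one_coe, pow_one] at h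
  intro W
  constructor
  · intro γ γ' e
    have e1 : γ ≫ φ = γ' ≫ φ :=
      congrArg (fun p : PreFrobenioid.PullbackHomData (ModelFrobenioid.toElem Φ B DivB) φ W => p.1.1) e
    have e2 : ModelFrobenioid.baseMap γ = ModelFrobenioid.baseMap γ' :=
      congrArg (fun p : PreFrobenioid.PullbackHomData (ModelFrobenioid.toElem Φ B DivB) φ W => p.1.2) e
    have hdeg : ModelFrobenioid.degFr φ * ModelFrobenioid.degFr γ =
        ModelFrobenioid.degFr φ * ModelFrobenioid.degFr γ' := congrArg ModelFrobenioid.Hom.degFr e1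
    have hdiv : pull Φ (ModelFrobenioid.baseMap γ) (ModelFrobenioid.div φ) *
          ModelFrobenioid.div γ ^ (ModelFrobenioid.degFr φ : ℕ) =
        pull Φ (ModelFrobenioid.baseMap γ') (ModelFrobenioid.div φ) *
          ModelFrobenioid.div γ' ^ (ModelFrobenioid.degFr φ : ℕ) := congrArg ModelFrobenioid.Hom.div e1
    have hun : pull B (ModelFrobenioid.baseMap γ) (ModelFrobenioid.unit φ) *
          ModelFrobenioid.unit γ ^ (ModelFrobenioid.degFr φ : ℕ) =
        pull B (ModelFrobenioid.baseMap γ') (ModelFrobenioid.unit φ) *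
          ModelFrobenioid.unit γ' ^ (ModelFrobenioid.degFr φ : ℕ) := congrArg ModelFrobenioid.Hom.unit e1
    rw [e2, hn, PNat.one_coe, pow_one, pow_one] at hdiv hun
    rw [hn, one_mul, one_mul] at hdeg
    rw [← hud, ← Units.coe_map] at hdiv
    rw [← huu, ← Units.coe_map] at hun
    exact ModelFrobenioid.hom_ext hdeg e2 ((Units.mul_right_inj _).mp hdiv) ((Units.mul_right_inj _).mp hun)
  · rintro ⟨⟨δ, ε⟩, hδ⟩
    let ε₀ : W.base ⟶ X.base := ε
    have hδ' : ModelFrobenioid.baseMap δ = ε₀ ≫ ModelFrobenioid.baseMap φ := hδ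
    -- the units `ε^* Div(φ)` of `Φ(W_D)` and `ε^* u_φ` of `B(W_D)`
    let ud' : (Φ.obj (op W.base))ˣ := Units.map (pull Φ ε₀ : _ →* _) ud
    let uu' : (B.obj (op W.base))ˣ := Units.map (pull B ε₀ : _ →* _) uu
    have hud' : (ud' : Φ.obj (op W.base)) = pull Φ ε₀ (ModelFrobenioid.div φ) := by rw [← hud]; rfl
    have huu' : (uu' : B.obj (op W.base)) = pull B ε₀ (ModelFrobenioid.unit φ) := by rw [← huu]; rfl
    refine ⟨ModelFrobenioid.mkHom W X (ModelFrobenioid.degFr δ) ε₀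
        (((ud'⁻¹ : (Φ.obj (op W.base))ˣ) : Φ.obj (op W.base)) * ModelFrobenioid.div δ)
        (((uu'⁻¹ : (B.obj (op W.base))ˣ) : B.obj (op W.base)) * ModelFrobenioid.unit δ) ?_,
      Subtype.ext (Prod.ext (ModelFrobenioid.hom_ext ?_ hδ'.symm ?_ ?_) rfl)⟩
    · have h1 := congrArg (pullGp Φ ε₀) hφ
      rw [map_mul, map_mul, PreFrobenioid.pullGp_of', ModelFrobenioid.pullGp_divB_pull, ← pullGp_comp, ← hδ',
        ← hud', ← huu'] at h1
      -- `h1 : ε^*α + Div(ε^*ud) = Base(δ)^*β + Div_B(ε^*uu)`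
      have h2 : pullGp Φ (ModelFrobenioid.baseMap δ) Y.cls =
          pullGp Φ ε₀ X.cls * Algebra.GrothendieckGroup.of (ud' : Φ.obj (op W.base)) *
            (divB Φ B DivB (op W.base) (uu' : B.obj (op W.base)))⁻¹ := by
        rw [h1, mul_inv_cancel_right]
      rw [map_mul, map_mul, map_units_inv, map_units_inv, mul_left_comm, ModelFrobenioid.rel δ, h2]
      exact inv_mul_rearrange _ _ _ _
    · show ModelFrobenioid.degFr φ * ModelFrobenioid.degFr δ = ModelFrobenioid.degFr δ
      rw [hn, one_mul]
    · show pull Φ ε₀ (ModelFrobenioid.div φ) *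
          (((ud'⁻¹ : (Φ.obj (op W.base))ˣ) : Φ.obj (op W.base)) * ModelFrobenioid.div δ) ^
            (ModelFrobenioid.degFr φ : ℕ) = ModelFrobenioid.div δ
      rw [hn, PNat.one_coe, pow_one, ← mul_assoc, ← hud', Units.mul_inv, one_mul]
    · show pull B ε₀ (ModelFrobenioid.unit φ) *
          (((uu'⁻¹ : (B.obj (op W.base))ˣ) : B.obj (op W.base)) * ModelFrobenioid.unit δ) ^
            (ModelFrobenioid.degFr φ : ℕ) = ModelFrobenioid.unit δ
      rw [hn, PNat.one_coe, pow_one, ← mul_assoc, ← huu', Units.mul_inv, one_mul]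

/-- Hence, with `B` group-like, the pull-back morphisms of a model Frobenioid are EXACTLY the linear morphisms with
unit zero divisor. [cite: MochizukiFrdI2008, Thm. 5.2(ii) p.101] -/
theorem isPullbackMorphism_iff_isUnit_div (hBg : Objectwise (fun M _ => IsGroupLike M) B) (φ : X ⟶ Y) :
    PreFrobenioid.IsPullbackMorphism (ModelFrobenioid.toElem Φ B DivB) φ ↔
      ModelFrobenioid.degFr φ = 1 ∧ IsUnit (ModelFrobenioid.div φ) :=
  ⟨degFr_eq_one_and_isUnit_div_of_isPullbackMorphism, fun h => isPullbackMorphism_of_isUnit_div hBg h.1 h.2⟩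

end Cor38BsFld

/-! ### The criterion for row C38-L07b over the typed interface -/

namespace TemperedFrobenioid

variable {D₀ : Type u₀} [Category.{v₀} D₀] {V : FrdIMonoidStub.{w}}
  {T : RealifiedDivisorMonoids (D₀ := D₀) V} {D : Type u} [Category.{v} D] {VD : FrdICatStub.{u, v, w} D}
  (C : TemperedFrobenioid T D VD)

/-- `0 ∈ Φ^{bs-fld}(A)` (local copy over `A : D` of abc-iut-w5-d124's `isBaseFieldTheoreticDiv_one`,
`Sec3Cor38CriterionLine.lean`, to keep the import light). [cite: MochizukiEtTh2009, Def 3.6 p.78] -/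
private theorem isBFTDiv_one (A : D) : C.IsBaseFieldTheoreticDiv (1 : C.divisorMonoid.obj (op A)) :=
  (C.bsFld.carrier (op A)).one_mem

/-- `Φ^{bs-fld}(A)` is a submonoid of `Φ(A)` (local copy of `isBaseFieldTheoreticDiv_mul`, loc. cit.).
[cite: MochizukiEtTh2009, Def 3.6 p.78] -/
private theorem isBFTDiv_mul {A : D} {x y : C.divisorMonoid.obj (op A)} (hx : C.IsBaseFieldTheoreticDiv x)
    (hy : C.IsBaseFieldTheoreticDiv y) : C.IsBaseFieldTheoreticDiv (x * y) :=
  (C.bsFld.carrier (op A)).mul_mem hx hy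

/-- `Φ^{bs-fld}` is a subfunctor: membership is preserved AND reflected by pull-back along an isomorphism of `D`.
[cite: MochizukiEtTh2009, Def 3.6 p.78] -/
theorem isBaseFieldTheoreticDiv_pull_iff {A A' : D} (f : A' ⟶ A) [IsIso f] (x : C.divisorMonoid.obj (op A)) :
    C.IsBaseFieldTheoreticDiv (pull C.divisorMonoid f x) ↔ C.IsBaseFieldTheoreticDiv x := by
  refine ⟨fun h => ?_, fun h => C.bsFld.map_mem f.op _ h⟩
  have h' : C.IsBaseFieldTheoreticDiv (pull C.divisorMonoid (inv f) (pull C.divisorMonoid f x)) :=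
    C.bsFld.map_mem (inv f).op _ h
  rwa [PreFrobenioid.pull_inv_pull_eq] at h'

/-- Multiplying by a UNIT that is base-field-theoretic together with its inverse neither creates nor destroys
base-field-theoreticity. [cite: MochizukiEtTh2009, Def 3.6 p.78] -/
theorem isBaseFieldTheoreticDiv_units_mul_iff {A : D} (w : (C.divisorMonoid.obj (op A))ˣ)
    (hw : C.IsBaseFieldTheoreticDiv (w : C.divisorMonoid.obj (op A)))
    (hw' : C.IsBaseFieldTheoreticDiv ((w⁻¹ : (C.divisorMonoid.obj (op A))ˣ) : C.divisorMonoid.obj (op A)))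
    (x : C.divisorMonoid.obj (op A)) :
    C.IsBaseFieldTheoreticDiv ((w : C.divisorMonoid.obj (op A)) * x) ↔ C.IsBaseFieldTheoreticDiv x := by
  refine ⟨fun h => ?_, fun h => isBFTDiv_mul C hw h⟩
  have h' := isBFTDiv_mul C hw' h
  rwa [Units.inv_mul_cancel_left] at h'

/-- **Row C38-L07b (F-2819), the exact criterion over the typed interface.**  For a tempered Frobenioid `C`
(Def. 3.6 (ii)), `C.BsFldOfFactorisation` — "for `f = F ≫ φ ≫ λ` (Frobenius type ≫ pre-step ≫ pull-back) `f` is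
base-field-theoretic iff `φ` is" — holds IF AND ONLY IF every unit of every divisor monoid `Φ(A)` lies in
`Φ^{bs-fld}(A)`.  (⇐): `Div(F ≫ φ ≫ λ) = Base(F)^*(Base(φ)^*Div(λ) + Div(φ))` with `Div(F) = 0`, `deg_Fr(λ) = 1` and
`Div(λ)` a unit (`Cor38BsFld.degFr_eq_one_and_isUnit_div_of_isPullbackMorphism`), and `Φ^{bs-fld}` is a subfunctor.
(⇒): for a unit `u ∈ Φ(A)` the morphisms `φ = (1, id, u, 0) : (A, 0) → (A, u)` (a pre-step) and
`λ = (1, id, −u, 0) : (A, u) → (A, 0)` (a pull-back morphism, `Cor38BsFld.isPullbackMorphism_of_isUnit_div`; `B` is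
group-like by `isUnit_BΛ`) have `Div(id ≫ φ ≫ λ) = 0 ∈ Φ^{bs-fld}`, whence `u = Div(φ) ∈ Φ^{bs-fld}`.
[cite: MochizukiEtTh2009, Cor 3.8 p.81] -/
theorem bsFldOfFactorisation_iff_isUnit :
    C.BsFldOfFactorisation ↔
      ∀ (A : D) (u : C.divisorMonoid.obj (op A)), IsUnit u → C.IsBaseFieldTheoreticDiv u := by
  constructor
  · intro h A u hu
    obtain ⟨uu, rfl⟩ := hu
    have hBg := C.ratFnFunctor_isGroupLike_holds
    -- the objects `(A, 0)`, `(A, u)` and the morphisms `φ = (1, id, u, 0)`, `λ = (1, id, -u, 0)`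
    let X₁ : C.category := ⟨A, 1⟩
    let X₂ : C.category := ⟨A, Algebra.GrothendieckGroup.of (uu : C.divisorMonoid.obj (op A))⟩
    let φ : X₁ ⟶ X₂ := ModelFrobenioid.mkHom X₁ X₂ 1 (𝟙 A) (uu : C.divisorMonoid.obj (op A)) 1 (by
      show (1 : Algebra.GrothendieckGroup (C.divisorMonoid.obj (op A))) ^ ((1 : ℕ+) : ℕ) *
          Algebra.GrothendieckGroup.of (uu : C.divisorMonoid.obj (op A)) =
        pullGp C.divisorMonoid (𝟙 A) (Algebra.GrothendieckGroup.of (uu : C.divisorMonoid.obj (op A))) *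
          Literature.AlgebraicGeometry.Frobenioids.divB C.divisorMonoid C.ratFnFunctor C.divBNatTrans (op A) 1
      rw [one_pow, one_mul, pullGp_id, map_one, mul_one])
    let l : X₂ ⟶ X₁ := ModelFrobenioid.mkHom X₂ X₁ 1 (𝟙 A)
        ((uu⁻¹ : (C.divisorMonoid.obj (op A))ˣ) : C.divisorMonoid.obj (op A)) 1 (by
      show Algebra.GrothendieckGroup.of (uu : C.divisorMonoid.obj (op A)) ^ ((1 : ℕ+) : ℕ) *
          Algebra.GrothendieckGroup.of ((uu⁻¹ : (C.divisorMonoid.obj (op A))ˣ) : C.divisorMonoid.obj (op A)) =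
        pullGp C.divisorMonoid (𝟙 A) 1 *
          Literature.AlgebraicGeometry.Frobenioids.divB C.divisorMonoid C.ratFnFunctor C.divBNatTrans (op A) 1
      rw [PNat.one_coe, pow_one, ← map_mul, Units.mul_inv, map_one, pullGp_id, map_one, mul_one])
    have hφ : C.opsData.IsPreStep φ :=
      (PreFrobenioidData.ofFunctor_isPreStep C.toElem φ).2 ⟨rfl, show IsIso (𝟙 A) from inferInstance⟩
    have hl : C.opsData.IsPullbackMorphism l :=
      (PreFrobenioidData.ofFunctor_isPullbackMorphism C.toElem l).2
        (Cor38BsFld.isPullbackMorphism_of_isUnit_div hBg rfl (uu⁻¹).isUnit)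
    have hF : C.opsData.IsFrobeniusType (𝟙 X₁) :=
      (PreFrobenioidData.ofFunctor_isFrobeniusType C.toElem _).2
        ⟨⟨ModelFrobenioid.isCoAngular hBg _, ModelFrobenioid.isIsometry_id _⟩, (ModelFrobenioid.isPreStep_id _).2⟩
    have h1 : C.IsBaseFieldTheoretic (𝟙 X₁ ≫ φ ≫ l) := by
      change C.IsBaseFieldTheoreticDiv (ModelFrobenioid.div (𝟙 X₁ ≫ φ ≫ l))
      rw [Category.id_comp, ModelFrobenioid.div_comp_pull]
      change C.IsBaseFieldTheoreticDiv (pull C.divisorMonoid (𝟙 A)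
          ((uu⁻¹ : (C.divisorMonoid.obj (op A))ˣ) : C.divisorMonoid.obj (op A)) *
        (uu : C.divisorMonoid.obj (op A)) ^ ((1 : ℕ+) : ℕ))
      rw [pull_id, PNat.one_coe, pow_one, Units.inv_mul]
      exact isBFTDiv_one C A
    exact (h (𝟙 X₁) φ l hF hφ hl).mp h1
  · intro hU A A' B' B F φ l hF _hφ hl
    have hFt' := (PreFrobenioidData.ofFunctor_isFrobeniusType C.toElem F).1 hF
    have hl' := (PreFrobenioidData.ofFunctor_isPullbackMorphism C.toElem l).1 hl
    obtain ⟨hdegl, hunit⟩ := Cor38BsFld.degFr_eq_one_and_isUnit_div_of_isPullbackMorphism hl'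
    have hdivF : ModelFrobenioid.div F = 1 := hFt'.1.2
    haveI : IsIso (ModelFrobenioid.baseMap F) := hFt'.2
    obtain ⟨w, hw⟩ := hunit.map (pull C.divisorMonoid (ModelFrobenioid.baseMap φ) : _ →* _)
    change C.IsBaseFieldTheoreticDiv (ModelFrobenioid.div (F ≫ φ ≫ l)) ↔
      C.IsBaseFieldTheoreticDiv (ModelFrobenioid.div φ)
    have hdiv : ModelFrobenioid.div (F ≫ φ ≫ l) = pull C.divisorMonoid (ModelFrobenioid.baseMap F)
        ((w : C.divisorMonoid.obj (op A'.base)) * ModelFrobenioid.div φ) := by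
      rw [ModelFrobenioid.div_comp_pull, ModelFrobenioid.div_comp_pull, hdivF, one_pow, mul_one, hdegl,
        PNat.one_coe, pow_one, hw]
    rw [hdiv, C.isBaseFieldTheoreticDiv_pull_iff]
    exact C.isBaseFieldTheoreticDiv_units_mul_iff w (hU _ _ w.isUnit) (hU _ _ (w⁻¹).isUnit) _

/-- **F-2819 at sharp divisor monoids (instance form, weaker than `IsFrobenioid C.toElem`).**  If every `Φ(A)` is
sharp — no unit but `0`, as for the perf-factorial divisorial monoid of print (Def. 3.6 (ii), p. 76) — then row
C38-L07b holds. [cite: MochizukiEtTh2009, Cor 3.8 p.81] -/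
theorem bsFldOfFactorisation_of_isSharp (hΦ : ∀ A : Dᵒᵖ, IsSharp (C.Φ.carrier A)) : C.BsFldOfFactorisation :=
  C.bsFldOfFactorisation_iff_isUnit.mpr fun A u hu => by
    rw [(hΦ (op A)).eq_one_of_isUnit u hu]
    exact isBFTDiv_one C A

/-- **F-2819 at divisorial divisor monoids** ([FrdI] Def. 1.1 (i): divisorial ⇒ sharp).
[cite: MochizukiEtTh2009, Cor 3.8 p.81] -/
theorem bsFldOfFactorisation_of_isDivisorial (hΦ : ∀ A : Dᵒᵖ, IsDivisorial (C.Φ.carrier A)) :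
    C.BsFldOfFactorisation :=
  C.bsFldOfFactorisation_of_isSharp fun A => (hΦ A).isSharp

/-- **F-2819 fails at any inhabitant with a non-base-field-theoretic unit**: a unit `u ∈ Φ(A)` outside
`Φ^{bs-fld}(A)` refutes row C38-L07b for that inhabitant of the typed interface (such inhabitants exist:
`Sec3Cor38BsFldOfFactorisationToy.lean`). [cite: MochizukiEtTh2009, Cor 3.8 p.81] -/
theorem not_bsFldOfFactorisation_of_isUnit {A : D} (u : C.divisorMonoid.obj (op A)) (hu : IsUnit u)
    (h : ¬ C.IsBaseFieldTheoreticDiv u) : ¬ C.BsFldOfFactorisation :=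
  fun H => h (C.bsFldOfFactorisation_iff_isUnit.mp H A u hu)

end TemperedFrobenioid

end Literature.AnabelianGeometry.EtaleTheta

end
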